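import Mathlib
import Summits.FinalStateConjecture.FinalStateConjecture.Theorems.PhotonSphereChannelsTortoiseFar

/-!
# Route PhotonSphereChannels — the RESCALED far potential `ρ²V(x_c + ρz)` is an `O(M log ρ / ρ)`
# perturbation of `ℓ(ℓ+1)/z²` (companion of `PhotonSphereChannelsFarPotential`, unit-scale form)

Helper file for the far half of `FixedModeChannels` (stmt-FinalStateConjecture-10048). With the
route's tortoise radius function `r` and Regge–Wheeler potential
`V(x) = (1 − 2M/r x)(ℓ(ℓ+1)/(r x)² + (1 − s²)2M/(r x)³)`, the rescaled potential at distance `ρ` from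
the photon sphere, `P(z) = ρ² V(x_c + ρ z)`, satisfies for `ρ ≥ 9M`, `s ≤ 2` and `z ≥ 3/8`

  `|P(z) − ℓ(ℓ+1)/z²| ≤ ε(ρ) z^{-5/2}`,  `ε(ρ) = 600 (ℓ(ℓ+1) + 1) (M/ρ) (1 + log(1 + ρ/M))`

(`rwPotential_far_estimate`, from `tortoise_far_asymptotics`), and for `ℓ = s = 0` the
non-degeneracy `2M/(81ρ) ≤ P(z)` on `[1, 2]` (`rwPotential_far_lower`). Elementary.
-/

namespace Summit.FinalStateConjecture.FinalStateConjecture.Theorems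

open Real Set Filter Topology

variable {M : ℝ} {r : ℝ → ℝ} {xc : ℝ}

/-- Powers of `z ≥ 3/8`: `(z³)⁻¹ ≤ 2 z^{-5/2}` and `√z (z³)⁻¹ = z^{-5/2}`. -/
theorem far_rpow_facts {z : ℝ} (hz : 3 / 8 ≤ z) :
    (z ^ 3)⁻¹ ≤ 2 * z ^ (-(5 : ℝ) / 2) ∧ Real.sqrt z * (z ^ 3)⁻¹ = z ^ (-(5 : ℝ) / 2) := by
  have hz0 : 0 < z := by linarith
  have e3 : (z ^ 3)⁻¹ = z ^ (-(3 : ℝ)) := by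
    rw [rpow_neg hz0.le, show (3 : ℝ) = ((3 : ℕ) : ℝ) by norm_num, rpow_natCast]
  have e5 : z ^ (-(3 : ℝ)) = z ^ (-(1 : ℝ) / 2) * z ^ (-(5 : ℝ) / 2) := by
    rw [← rpow_add hz0]; norm_num
  constructor
  · rw [e3, e5]
    refine mul_le_mul_of_nonneg_right ?_ (rpow_nonneg hz0.le _)
    -- `z^{-1/2} ≤ (3/8)^{-1/2} ≤ 2`
    have h1 : z ^ (-(1 : ℝ) / 2) ≤ (3 / 8 : ℝ) ^ (-(1 : ℝ) / 2) :=
      rpow_le_rpow_of_nonpos (by norm_num) hz (by norm_num)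
    have h2 : (3 / 8 : ℝ) ^ (-(1 : ℝ) / 2) ≤ 2 := by
      have h4 : ((3 / 8 : ℝ) ^ (-(1 : ℝ) / 2)) ^ 2 = 8 / 3 := by
        rw [← rpow_natCast ((3 / 8 : ℝ) ^ (-(1 : ℝ) / 2)) 2, ← rpow_mul (by norm_num)]
        norm_num
      have h5 : 0 ≤ (3 / 8 : ℝ) ^ (-(1 : ℝ) / 2) := rpow_nonneg (by norm_num) _
      nlinarith
    exact h1.trans h2
  · rw [Real.sqrt_eq_rpow, e3, ← rpow_add hz0]; norm_num

/-- `log(1 + ab) ≤ log(1 + a) + 2√b` for `a, b ≥ 0` (`log(1+b) ≤ 2√b`). -/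
theorem log_one_add_mul_le {a b : ℝ} (ha : 0 ≤ a) (hb : 0 ≤ b) :
    Real.log (1 + a * b) ≤ Real.log (1 + a) + 2 * Real.sqrt b := by
  have h1 : Real.log (1 + a * b) ≤ Real.log ((1 + a) * (1 + b)) :=
    Real.log_le_log (by positivity) (by nlinarith)
  rw [Real.log_mul (by positivity) (by positivity)] at h1
  have h2 : Real.log (1 + b) ≤ 2 * Real.sqrt b := by
    have hs : Real.log (1 + b) = 2 * Real.log (Real.sqrt (1 + b)) := by
      rw [Real.log_sqrt (by positivity)]; ring
    rw [hs]
    have h3 : Real.log (Real.sqrt (1 + b)) ≤ Real.sqrt (1 + b) - 1 :=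
      Real.log_le_sub_one_of_pos (Real.sqrt_pos.2 (by positivity))
    have h4 : Real.sqrt (1 + b) ≤ 1 + Real.sqrt b := by
      rw [Real.sqrt_le_left (by positivity)]
      nlinarith [Real.sq_sqrt hb, Real.sqrt_nonneg b]
    linarith
  linarith

/-- The `1/r³` term of the rescaled potential: `|ρ² (1−2M/r) β/r³| ≤ 162 M/(ρ z³)` when
`|β| ≤ 6M`, `r ≥ ρz/3`. -/
theorem far_term_cube {M ρ z rr β red : ℝ} (hM : 0 < M) (hρ : 0 < ρ) (hz : 0 < z)
    (hrr0 : 0 < rr) (hrr3 : ρ * z / 3 ≤ rr) (hred0 : 0 < red) (hred1 : red ≤ 1) (hβ : |β| ≤ 6 * M) :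
    |ρ ^ 2 * (red * (β / rr ^ 3))| ≤ 162 * M / (ρ * z ^ 3) := by
  rw [abs_mul, abs_mul, abs_of_pos (by positivity : (0:ℝ) < ρ ^ 2), abs_of_pos hred0, abs_div,
    abs_of_pos (by positivity : (0:ℝ) < rr ^ 3)]
  have h1 : ρ ^ 2 * (red * (|β| / rr ^ 3)) ≤ ρ ^ 2 * (1 * (6 * M / rr ^ 3)) := by
    refine mul_le_mul_of_nonneg_left (mul_le_mul hred1 ?_ (by positivity) zero_le_one)
      (by positivity)
    exact div_le_div_of_nonneg_right hβ (by positivity)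
  have h2 : ρ ^ 2 * (1 * (6 * M / rr ^ 3)) ≤ 162 * M / (ρ * z ^ 3) := by
    rw [one_mul, ← mul_div_assoc, div_le_div_iff₀ (by positivity) (by positivity)]
    have h3 : (ρ * z / 3) ^ 3 ≤ rr ^ 3 := pow_le_pow_left₀ (by positivity) hrr3 3
    have e : 162 * M * rr ^ 3 - ρ ^ 2 * (6 * M) * (ρ * z ^ 3) = 162 * M * (rr ^ 3 - (ρ * z / 3) ^ 3) := by
      ring
    nlinarith
  exact h1.trans h2

/-- The `1/r²` term of the rescaled potential: `|ρ²(1−2M/r)/r² − 1/z²| ≤ 9(15M + 3δ)/(ρ z³)` with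
`δ = ρz + 3M − r ≥ 0`, `r ≥ ρz/3`, `ρ z ≥ 3M`. -/
theorem far_term_square {M ρ z rr δ : ℝ} (hM : 0 < M) (hρ : 0 < ρ) (hz : 0 < z) (hrr0 : 0 < rr)
    (hrr3 : ρ * z / 3 ≤ rr) (hdM : 3 * M ≤ ρ * z) (hδ : δ = ρ * z + 3 * M - rr) (hδ0 : 0 ≤ δ) :
    |ρ ^ 2 * ((1 - 2 * M / rr) * (1 / rr ^ 2)) - 1 / z ^ 2| ≤ 9 * (15 * M + 3 * δ) / (ρ * z ^ 3) := by
  set d : ℝ := ρ * z with hd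
  have hd0 : 0 < d := by positivity
  have e : ρ ^ 2 * ((1 - 2 * M / rr) * (1 / rr ^ 2)) - 1 / z ^ 2
      = (d ^ 2 - rr ^ 2 - 2 * M * d ^ 2 / rr) / (rr ^ 2 * z ^ 2) := by
    simp only [hd]; field_simp; ring
  rw [e, abs_div, abs_of_pos (by positivity : (0:ℝ) < rr ^ 2 * z ^ 2),
    div_le_div_iff₀ (by positivity) (by positivity)]
  have hnum : |d ^ 2 - rr ^ 2 - 2 * M * d ^ 2 / rr| ≤ d * (15 * M + 3 * δ) := by
    have h1 : d ^ 2 - rr ^ 2 = (δ - 3 * M) * (d + rr) := by rw [hδ]; ring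
    have h2 : |(δ - 3 * M) * (d + rr)| ≤ (3 * M + δ) * (3 * d) := by
      rw [abs_mul, abs_of_pos (by positivity : (0:ℝ) < d + rr)]
      refine mul_le_mul (abs_le.2 ⟨by linarith, by linarith⟩) ?_ (by positivity) (by positivity)
      have : rr ≤ d + 3 * M := by rw [hδ] at hδ0; linarith
      linarith
    have h3 : |2 * M * d ^ 2 / rr| ≤ 6 * M * d := by
      rw [abs_of_nonneg (by positivity), div_le_iff₀ hrr0]
      nlinarith [mul_pos hM hd0]
    calc |d ^ 2 - rr ^ 2 - 2 * M * d ^ 2 / rr| ≤ |d ^ 2 - rr ^ 2| + |2 * M * d ^ 2 / rr| :=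
          abs_sub _ _
      _ ≤ (3 * M + δ) * (3 * d) + 6 * M * d := by rw [h1]; exact add_le_add h2 h3
      _ = d * (15 * M + 3 * δ) := by ring
  have hden : ρ ^ 2 * z ^ 4 / 9 ≤ rr ^ 2 * z ^ 2 := by
    have h3 : (d / 3) ^ 2 ≤ rr ^ 2 := pow_le_pow_left₀ (by positivity) hrr3 2
    have : ρ ^ 2 * z ^ 4 / 9 = (d / 3) ^ 2 * z ^ 2 := by simp only [hd]; ring
    rw [this]; exact mul_le_mul_of_nonneg_right h3 (by positivity)
  calc |d ^ 2 - rr ^ 2 - 2 * M * d ^ 2 / rr| * (ρ * z ^ 3)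
      ≤ d * (15 * M + 3 * δ) * (ρ * z ^ 3) := mul_le_mul_of_nonneg_right hnum (by positivity)
    _ = 9 * (15 * M + 3 * δ) * (ρ ^ 2 * z ^ 4 / 9) := by simp only [hd]; ring
    _ ≤ 9 * (15 * M + 3 * δ) * (rr ^ 2 * z ^ 2) := mul_le_mul_of_nonneg_left hden (by positivity)

/-- The final arithmetic of `rwPotential_far_estimate`. -/
theorem far_estimate_arith {M ρ z L δ A : ℝ} (hM : 0 < M) (hρ : 0 < ρ) (hz : 3 / 8 ≤ z)
    (hL0 : 0 ≤ L) (hA : 0 ≤ A) (hδ1 : δ ≤ 6 * M * (L + 2 * Real.sqrt z)) :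
    A * (9 * (15 * M + 3 * δ) / (ρ * z ^ 3)) + 162 * M / (ρ * z ^ 3)
      ≤ 600 * (A + 1) * (M / ρ) * (1 + L) * z ^ (-(5 : ℝ) / 2) := by
  have hz0 : 0 < z := by linarith
  obtain ⟨hz3, hzs⟩ := far_rpow_facts hz
  have hzi : 0 < ρ * z ^ 3 := by positivity
  have e1 : 9 * (15 * M + 3 * δ) / (ρ * z ^ 3) ≤ 9 * (15 * M + 18 * M * (L + 2 * Real.sqrt z))
      / (ρ * z ^ 3) := div_le_div_of_nonneg_right (by linarith [hδ1]) hzi.le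
  have hA' : 9 * (15 * M + 18 * M * (L + 2 * Real.sqrt z)) / (ρ * z ^ 3)
      = (M / ρ) * ((135 + 162 * L) * (z ^ 3)⁻¹ + 324 * (Real.sqrt z * (z ^ 3)⁻¹)) := by
    field_simp; ring
  have hB : 162 * M / (ρ * z ^ 3) = (M / ρ) * (162 * (z ^ 3)⁻¹) := by field_simp
  have hMρ : 0 ≤ M / ρ := by positivity
  have hzp : 0 ≤ z ^ (-(5 : ℝ) / 2) := rpow_nonneg hz0.le _
  have hint : (135 + 162 * L) * (z ^ 3)⁻¹ ≤ (135 + 162 * L) * (2 * z ^ (-(5 : ℝ) / 2)) :=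
    mul_le_mul_of_nonneg_left hz3 (by positivity)
  have h1 : (135 + 162 * L) * (z ^ 3)⁻¹ + 324 * z ^ (-(5 : ℝ) / 2)
      ≤ (594 + 324 * L) * z ^ (-(5 : ℝ) / 2) := by linarith [hint]
  have h2 : 162 * (z ^ 3)⁻¹ ≤ 324 * z ^ (-(5 : ℝ) / 2) := by linarith [hz3]
  calc A * (9 * (15 * M + 3 * δ) / (ρ * z ^ 3)) + 162 * M / (ρ * z ^ 3)
      ≤ A * (9 * (15 * M + 18 * M * (L + 2 * Real.sqrt z)) / (ρ * z ^ 3)) + 162 * M / (ρ * z ^ 3) :=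
        add_le_add (mul_le_mul_of_nonneg_left e1 hA) le_rfl
    _ = A * ((M / ρ) * ((135 + 162 * L) * (z ^ 3)⁻¹ + 324 * z ^ (-(5 : ℝ) / 2)))
        + (M / ρ) * (162 * (z ^ 3)⁻¹) := by rw [hA', hB, hzs]
    _ ≤ A * ((M / ρ) * ((594 + 324 * L) * z ^ (-(5 : ℝ) / 2))) + (M / ρ) * (324 * z ^ (-(5 : ℝ) / 2)) :=
        add_le_add (mul_le_mul_of_nonneg_left (mul_le_mul_of_nonneg_left h1 hMρ) hA)
          (mul_le_mul_of_nonneg_left h2 hMρ)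
    _ = (A * (594 + 324 * L) + 324) * ((M / ρ) * z ^ (-(5 : ℝ) / 2)) := by ring
    _ ≤ (600 * (A + 1) * (1 + L)) * ((M / ρ) * z ^ (-(5 : ℝ) / 2)) := by
        refine mul_le_mul_of_nonneg_right ?_ (mul_nonneg hMρ hzp)
        nlinarith [mul_nonneg hA hL0]
    _ = 600 * (A + 1) * (M / ρ) * (1 + L) * z ^ (-(5 : ℝ) / 2) := by ring

/-- **The rescaled far potential is close to `ℓ(ℓ+1)/z²`.** See the module docstring. -/
theorem rwPotential_far_estimate (hM : 0 < M) (hr : ∀ x, 2 * M < r x)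
    (hr' : ∀ x, HasDerivAt r (1 - 2 * M / r x) x) (hxc : r xc = 3 * M) (ℓ s : ℕ) (hs : s ≤ 2)
    {ρ : ℝ} (hρ : 9 * M ≤ ρ) {z : ℝ} (hz : 3 / 8 ≤ z) :
    |ρ ^ 2 * ((1 - 2 * M / r (xc + ρ * z)) * ((ℓ : ℝ) * ((ℓ : ℝ) + 1) / r (xc + ρ * z) ^ 2
        + (1 - (s : ℝ) ^ 2) * (2 * M) / r (xc + ρ * z) ^ 3)) - (ℓ : ℝ) * ((ℓ : ℝ) + 1) / z ^ 2|
      ≤ 600 * ((ℓ : ℝ) * ((ℓ : ℝ) + 1) + 1) * (M / ρ) * (1 + Real.log (1 + ρ / M))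
        * z ^ (-(5 : ℝ) / 2) := by
  have hρ0 : 0 < ρ := by linarith
  have hz0 : 0 < z := by linarith
  have hdM : 3 * M ≤ ρ * z := by nlinarith
  have hx : xc ≤ xc + ρ * z := by nlinarith
  set rr : ℝ := r (xc + ρ * z) with hrr
  have hrr2 : 2 * M < rr := hr _
  have hrr0 : 0 < rr := by linarith
  have hlo : 3 * M + ρ * z / 3 ≤ rr := by
    have := tortoise_ge_third hM hr hr' hxc hx; simp only [add_sub_cancel_left] at this; exact this
  obtain ⟨hdef0, hdef⟩ := tortoise_far_asymptotics hM hr hr' hxc hx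
  simp only [add_sub_cancel_left] at hdef0 hdef
  set L : ℝ := Real.log (1 + ρ / M) with hL
  have hL0 : 0 ≤ L := Real.log_nonneg (by
    have : 0 ≤ ρ / M := div_nonneg hρ0.le hM.le; linarith)
  have hΛ : 6 * M * Real.log (1 + ρ * z / (9 * M)) ≤ 6 * M * (L + 2 * Real.sqrt z) := by
    refine mul_le_mul_of_nonneg_left ?_ (by positivity)
    have h1 : Real.log (1 + ρ * z / (9 * M)) ≤ Real.log (1 + ρ / M * z) := by
      refine Real.log_le_log (by positivity) ?_
      have : ρ * z / (9 * M) ≤ ρ / M * z := by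
        rw [div_mul_eq_mul_div, div_le_div_iff₀ (by positivity) hM]; nlinarith
      linarith
    exact h1.trans (log_one_add_mul_le (div_nonneg hρ0.le hM.le) hz0.le)
  set δ : ℝ := ρ * z + 3 * M - rr with hδ
  have hδ1 : δ ≤ 6 * M * (L + 2 * Real.sqrt z) := hdef.trans hΛ
  have hrr3 : ρ * z / 3 ≤ rr := by linarith
  have hred0 : 0 < 1 - 2 * M / rr := by rw [sub_pos, div_lt_one hrr0]; exact hrr2
  have hred1 : 1 - 2 * M / rr ≤ 1 := by
    have : 0 ≤ 2 * M / rr := by positivity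
    linarith
  have hβ : |(1 - (s : ℝ) ^ 2) * (2 * M)| ≤ 6 * M := by
    interval_cases s <;> norm_num [abs_of_pos hM] <;> nlinarith
  have hT2 := far_term_cube (β := (1 - (s : ℝ) ^ 2) * (2 * M)) hM hρ0 hz0 hrr0 hrr3 hred0 hred1 hβ
  have hT1 := far_term_square hM hρ0 hz0 hrr0 hrr3 hdM hδ hdef0
  have hℓ : (0 : ℝ) ≤ (ℓ : ℝ) * ((ℓ : ℝ) + 1) := by positivity
  have hsplit : ρ ^ 2 * ((1 - 2 * M / rr) * ((ℓ : ℝ) * ((ℓ : ℝ) + 1) / rr ^ 2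
      + (1 - (s : ℝ) ^ 2) * (2 * M) / rr ^ 3)) - (ℓ : ℝ) * ((ℓ : ℝ) + 1) / z ^ 2
      = (ℓ : ℝ) * ((ℓ : ℝ) + 1) * (ρ ^ 2 * ((1 - 2 * M / rr) * (1 / rr ^ 2)) - 1 / z ^ 2)
        + ρ ^ 2 * ((1 - 2 * M / rr) * ((1 - (s : ℝ) ^ 2) * (2 * M) / rr ^ 3)) := by ring
  rw [hsplit]
  calc |(ℓ : ℝ) * ((ℓ : ℝ) + 1) * (ρ ^ 2 * ((1 - 2 * M / rr) * (1 / rr ^ 2)) - 1 / z ^ 2)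
        + ρ ^ 2 * ((1 - 2 * M / rr) * ((1 - (s : ℝ) ^ 2) * (2 * M) / rr ^ 3))|
      ≤ |(ℓ : ℝ) * ((ℓ : ℝ) + 1) * (ρ ^ 2 * ((1 - 2 * M / rr) * (1 / rr ^ 2)) - 1 / z ^ 2)|
        + |ρ ^ 2 * ((1 - 2 * M / rr) * ((1 - (s : ℝ) ^ 2) * (2 * M) / rr ^ 3))| := abs_add_le _ _
    _ ≤ (ℓ : ℝ) * ((ℓ : ℝ) + 1) * (9 * (15 * M + 3 * δ) / (ρ * z ^ 3)) + 162 * M / (ρ * z ^ 3) := by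
        rw [abs_mul, abs_of_nonneg hℓ]
        exact add_le_add (mul_le_mul_of_nonneg_left hT1 hℓ) hT2
    _ ≤ _ := far_estimate_arith hM hρ0 hz hL0 hℓ hδ1

/-- **Non-degeneracy for `ℓ = s = 0`**: `2M/(81ρ) ≤ ρ² V(x_c + ρ z)` for `z ∈ [1,2]`, `ρ ≥ 3M`. -/
theorem rwPotential_far_lower (hM : 0 < M) (hr : ∀ x, 2 * M < r x)
    (hr' : ∀ x, HasDerivAt r (1 - 2 * M / r x) x) (hxc : r xc = 3 * M)
    {ρ : ℝ} (hρ : 3 * M ≤ ρ) {z : ℝ} (hz : 1 ≤ z) (hz2 : z ≤ 2) :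
    2 * M / (81 * ρ) ≤ ρ ^ 2 * ((1 - 2 * M / r (xc + ρ * z))
      * (((0:ℕ) : ℝ) * (((0:ℕ) : ℝ) + 1) / r (xc + ρ * z) ^ 2
        + (1 - ((0:ℕ) : ℝ) ^ 2) * (2 * M) / r (xc + ρ * z) ^ 3)) := by
  have hρ0 : 0 < ρ := by linarith
  have hx : xc ≤ xc + ρ * z := by nlinarith
  set rr : ℝ := r (xc + ρ * z) with hrr
  have h3 : 3 * M ≤ rr := (three_mul_le_tortoise_iff hM hr hr' hxc _).2 hx
  have hhi : rr ≤ ρ * z + 3 * M := by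
    have := tortoise_le_add hM hr hr' hxc hx; simp only [add_sub_cancel_left] at this; exact this
  have hr3ρ : rr ≤ 3 * ρ := by nlinarith
  have hrr0 : 0 < rr := by linarith
  have hred : 1 / 3 ≤ 1 - 2 * M / rr := by
    have : 2 * M / rr ≤ 2 / 3 := by rw [div_le_div_iff₀ hrr0 (by norm_num)]; linarith
    linarith
  simp only [Nat.cast_zero, zero_mul, zero_div, zero_add, sub_zero, one_mul, zero_pow two_ne_zero]
  -- `ρ² (1 − 2M/rr) (2M/rr³) ≥ ρ² (1/3) (2M/(27ρ³)) = 2M/(81ρ)`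
  have h1 : 2 * M / (3 * ρ) ^ 3 ≤ 2 * M / rr ^ 3 :=
    div_le_div_of_nonneg_left (by positivity) (by positivity) (pow_le_pow_left₀ hrr0.le hr3ρ 3)
  calc 2 * M / (81 * ρ) = ρ ^ 2 * ((1 / 3) * (2 * M / (3 * ρ) ^ 3)) := by field_simp; ring
    _ ≤ ρ ^ 2 * ((1 - 2 * M / rr) * (2 * M / rr ^ 3)) := by
        refine mul_le_mul_of_nonneg_left (mul_le_mul hred h1 (by positivity) (by linarith))
          (by positivity)

/-- **The smallness parameters tend to zero**: `log(1+u)ⁿ/u → 0` as `u → ∞`. -/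
theorem tendsto_log_one_add_pow_div (n : ℕ) :
    Tendsto (fun u : ℝ => Real.log (1 + u) ^ n / u) atTop (𝓝 0) := by
  have h := Real.tendsto_pow_log_div_mul_add_atTop 1 (-1) n one_ne_zero
  have h2 : Tendsto (fun u : ℝ => 1 + u) atTop atTop := tendsto_atTop_add_const_left _ _ tendsto_id
  refine (h.comp h2).congr' ?_
  filter_upwards [eventually_gt_atTop (0:ℝ)] with u hu
  simp only [Function.comp_def]
  congr 1; ring

/-- `(M/ρ)(1 + log(1 + ρ/M))² → 0` as `ρ → ∞` (`M > 0`). -/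
theorem tendsto_far_smallness (hM : 0 < M) :
    Tendsto (fun ρ : ℝ => M / ρ * (1 + Real.log (1 + ρ / M)) ^ 2) atTop (𝓝 0) := by
  -- in the variable `u = ρ/M`
  have hu : Tendsto (fun ρ : ℝ => ρ / M) atTop atTop := tendsto_id.atTop_div_const hM
  have key : Tendsto (fun u : ℝ => u⁻¹ * (1 + Real.log (1 + u)) ^ 2) atTop (𝓝 0) := by
    have h0 : Tendsto (fun u : ℝ => u⁻¹) atTop (𝓝 0) := tendsto_inv_atTop_zero
    have h1 := tendsto_log_one_add_pow_div 1
    have h2 := tendsto_log_one_add_pow_div 2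
    have hsum : Tendsto (fun u : ℝ => u⁻¹ + 2 * (Real.log (1 + u) ^ 1 / u)
        + Real.log (1 + u) ^ 2 / u) atTop (𝓝 (0 + 2 * 0 + 0)) :=
      (h0.add (h1.const_mul 2)).add h2
    simp only [mul_zero, add_zero] at hsum
    refine hsum.congr' ?_
    filter_upwards [eventually_gt_atTop (0:ℝ)] with u hu
    field_simp
    ring
  have hcomp := key.comp hu
  refine hcomp.congr' ?_
  filter_upwards [eventually_gt_atTop (0:ℝ)] with ρ hρ
  simp only [Function.comp_def]
  rw [inv_div]

/-- **Choice of `ρ₀`**: beyond some `ρ₀ ≥ 9M` the smallness parameter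
`ε(ρ) = C (M/ρ)(1 + log(1 + ρ/M))` satisfies `ε(ρ) ≤ ε₀` and `ε(ρ)² ≤ ε₀ · 2M/(81ρ)`. -/
theorem far_exists_rho0 (hM : 0 < M) {C ε₀ : ℝ} (hC : 0 ≤ C) (hε₀ : 0 < ε₀) :
    ∃ ρ₀ : ℝ, 9 * M ≤ ρ₀ ∧ ∀ ρ, ρ₀ ≤ ρ →
      C * (M / ρ) * (1 + Real.log (1 + ρ / M)) ≤ ε₀ ∧
      (C * (M / ρ) * (1 + Real.log (1 + ρ / M))) ^ 2 ≤ ε₀ * (2 * M / (81 * ρ)) := by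
  have ht := tendsto_far_smallness hM
  -- `ε ≤ ε₀` eventually: `ε ≤ C (M/ρ)(1+L)² ≤ …` since `1 + L ≥ 1`
  have h1 : ∀ᶠ ρ in atTop, C * (M / ρ) * (1 + Real.log (1 + ρ / M)) ≤ ε₀ := by
    have hev := (ht.const_mul C).eventually (Iic_mem_nhds (by simpa using hε₀ : C * 0 < ε₀))
    filter_upwards [hev, eventually_gt_atTop (0:ℝ)] with ρ hρ hρ0
    have hL : 0 ≤ Real.log (1 + ρ / M) := Real.log_nonneg (by
      have : 0 ≤ ρ / M := div_nonneg hρ0.le hM.le; linarith)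
    have hMρ : 0 ≤ M / ρ := div_nonneg hM.le hρ0.le
    have : C * (M / ρ) * (1 + Real.log (1 + ρ / M))
        ≤ C * (M / ρ * (1 + Real.log (1 + ρ / M)) ^ 2) := by
      rw [mul_assoc]
      refine mul_le_mul_of_nonneg_left ?_ hC
      refine mul_le_mul_of_nonneg_left ?_ hMρ
      nlinarith
    exact this.trans hρ
  -- `ε² ≤ ε₀ 2M/(81ρ)` eventually: `ε² = C² (M/ρ) · [(M/ρ)(1+L)²]`
  have h2 : ∀ᶠ ρ in atTop, (C * (M / ρ) * (1 + Real.log (1 + ρ / M))) ^ 2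
      ≤ ε₀ * (2 * M / (81 * ρ)) := by
    have hsmall : (0:ℝ) < 2 * ε₀ / (81 * (C ^ 2 + 1)) := by positivity
    have hev := ht.eventually (Iic_mem_nhds hsmall)
    filter_upwards [hev, eventually_gt_atTop (0:ℝ)] with ρ hρ hρ0
    have hMρ : 0 < M / ρ := div_pos hM hρ0
    set S : ℝ := M / ρ * (1 + Real.log (1 + ρ / M)) ^ 2 with hS
    have hS0 : 0 ≤ S := by positivity
    have e : (C * (M / ρ) * (1 + Real.log (1 + ρ / M))) ^ 2 = C ^ 2 * (M / ρ) * S := by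
      simp only [hS]; ring
    have e2 : ε₀ * (2 * M / (81 * ρ)) = (2 * ε₀ / 81) * (M / ρ) := by field_simp
    rw [e, e2]
    have hS1 : S ≤ 2 * ε₀ / (81 * (C ^ 2 + 1)) := hρ
    have : C ^ 2 * S ≤ 2 * ε₀ / 81 := by
      calc C ^ 2 * S ≤ (C ^ 2 + 1) * S := by nlinarith
        _ ≤ (C ^ 2 + 1) * (2 * ε₀ / (81 * (C ^ 2 + 1))) :=
            mul_le_mul_of_nonneg_left hS1 (by positivity)
        _ = 2 * ε₀ / 81 := by field_simp
    nlinarith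
  obtain ⟨ρ₁, hρ₁⟩ := (h1.and (h2.and (eventually_ge_atTop (9 * M)))).exists_forall_of_atTop
  refine ⟨max ρ₁ (9 * M), le_max_right _ _, fun ρ hρ => ?_⟩
  obtain ⟨a, b, -⟩ := hρ₁ ρ ((le_max_left _ _).trans hρ)
  exact ⟨a, b⟩

end Summit.FinalStateConjecture.FinalStateConjecture.Theorems
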